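import Mathlib

/-!
# Solo (informed) rung s26/4: the twist of the augmentation filtration

In the group ring of a cyclic group `⟨g⟩` the automorphism `g ↦ gᵃ` acts on the graded piece
`Iᵏ/Iᵏ⁺¹` of the augmentation filtration (spanned by `(g-1)ᵏ`) through the scalar `aᵏ`:
writing `X = g - 1`, one has `(gᵃ - 1)ᵏ = ((1+X)ᵃ - 1)ᵏ = Xᵏ · Pᵏ` with `P(0) = a`.  This is
the algebra behind "eigenvalue `ω^{t+d}` at depth `d`" in the two-strand model of
paper §16.13(h)(5′): the `Δ`-action on depth `d` of a strand with top character `ω^t` is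
`ω^t · ω^d`.  We prove the polynomial identities over an arbitrary commutative ring.
-/

namespace Summit.Langlands.Langlands.Theorems

open Polynomial Finset

/-- `(1+X)^a - 1 = (∑_{i<a} (1+X)^i) · X`. -/
theorem soloInformed_onePlusX_pow_sub_one {R : Type*} [CommRing R] (a : ℕ) :
    ((1 + X : R[X]) ^ a - 1) = (∑ i ∈ range a, (1 + X : R[X]) ^ i) * X := by
  have h := geom_sum_mul (1 + X : R[X]) a
  rw [add_sub_cancel_left] at h
  exact h.symm

/-- The depth-`k` twist: `((1+X)^a - 1)^k = Q · X^k` with `Q = (∑_{i<a} (1+X)^i)^k`. -/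
theorem soloInformed_augmentation_pow {R : Type*} [CommRing R] (a k : ℕ) :
    ((1 + X : R[X]) ^ a - 1) ^ k = (∑ i ∈ range a, (1 + X : R[X]) ^ i) ^ k * X ^ k := by
  rw [soloInformed_onePlusX_pow_sub_one, mul_pow]

/-- The scalar by which `g ↦ gᵃ` acts on `Iᵏ/Iᵏ⁺¹`: the coefficient of `Xᵏ` in
`((1+X)^a - 1)^k` is `a^k`. -/
theorem soloInformed_augmentation_twist {R : Type*} [CommRing R] (a k : ℕ) :
    (((1 + X : R[X]) ^ a - 1) ^ k).coeff k = (a : R) ^ k := by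
  rw [soloInformed_augmentation_pow]
  have h0 : ((∑ i ∈ range a, (1 + X : R[X]) ^ i) ^ k).coeff 0 = (a : R) ^ k := by
    rw [coeff_zero_eq_eval_zero, eval_pow, eval_finsetSum]
    simp
  have h := coeff_mul_X_pow ((∑ i ∈ range a, (1 + X : R[X]) ^ i) ^ k) k 0
  rw [zero_add] at h
  rw [h, h0]

/-- Below depth `k` nothing survives: the coefficients of `X^j`, `j < k`, vanish. -/
theorem soloInformed_augmentation_twist_lower {R : Type*} [CommRing R] (a k j : ℕ)
    (hj : j < k) : (((1 + X : R[X]) ^ a - 1) ^ k).coeff j = 0 := by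
  rw [soloInformed_augmentation_pow, coeff_mul_X_pow', if_neg (not_le.mpr hj)]

end Summit.Langlands.Langlands.Theorems
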